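import Literature.Analysis.FunctionSpaces.TorusCubeDescentRungs
import HarnessLib

/-!
# W3-E (ii): arithmetic tools of the band-kill ladder — cube-in-ball geometry at the sharp constant and the lacunary level sum
# (helper for K1L_D `stmt-AnomalousDissipation-27980`, `stub_effectiveFrameEnergyL_bandKill`)

Summits-side helper file (everything proved; no definitions, no named facts).
* §1 `cubeSupp_subset_freqBall_of_sq`: `cube(R) ⊆ ball(L)` in `ℤ³` as soon as `3R² ≤ L²` (the tree's `OneLevelSplit.cubeSupp_subset_freqBall`
  asks `2R ≤ L`, which leaves no room for a ladder between the balls `L' = L/2` and `L`; with `R = ⌊4L/7⌋` there is room `L/14`);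
  `three_mul_sq_div_le`: `R = 4L/7` (integer division) satisfies `3R² ≤ L²`.
* §2 `lacunary_sum_mul_exp_le`: for cell counts `N` with `2N_i ≤ N_{i+1}` and `α > 0`,
  `Σ_{i<m} (L/N_{i+1}) exp(−(L/N_{i+1})/α) ≤ 4α` — the levels' amplitudes `u_i = L/N_{i+1}` form a lacunary sequence, and
  `u e^{−u/α} ≤ min(u, α²/u)`; both pieces are geometric sums (this is what makes the tail term of the ladder condition uniform in
  the number of levels and in `L/N_m`, cell note F-k3l-8).
Infrastructure for route-1's rung leaf F-D1.A0 (a frontier FORMAL rung); NOT a proof of anomalous dissipation.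
-/

set_option linter.dupNamespace false

noncomputable section

namespace Summit.AnomalousDissipation.AnomalousDissipation.Theorems.SolenoidalFractalHomogenisation.LagrangianCarrierAnalytic

open Set Function Finset
open Literature.Analysis Literature.Analysis.FunctionSpaces Literature.Analysis.FunctionSpaces.Torus

/-! ## §1 Cube inside ball at the sharp constant -/

/-- `cube(R) ⊆ ball(L)` in `ℤ³` when `3R² ≤ L²`. [cite: Grafakos2014, §3.1.1] -/
theorem cubeSupp_subset_freqBall_of_sq {R L : ℕ} (h : 3 * R ^ 2 ≤ L ^ 2) : cubeSupp (Fin 3) R ⊆ freqBall L := by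
  intro k hk
  rw [mem_cubeSupp] at hk
  rw [mem_freqBall]
  have hki : ∀ i, ((k i : ℝ)) ^ 2 ≤ (R : ℝ) ^ 2 := fun i => by
    have h1 : |(k i : ℝ)| ≤ R := by exact_mod_cast hk i
    have h0 : 0 ≤ |(k i : ℝ)| := abs_nonneg _
    calc ((k i : ℝ)) ^ 2 = |(k i : ℝ)| ^ 2 := (sq_abs _).symm
      _ ≤ (R : ℝ) ^ 2 := pow_le_pow_left₀ h0 h1 2
  have h3 : (3 : ℝ) * (R : ℝ) ^ 2 ≤ (L : ℝ) ^ 2 := by exact_mod_cast h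
  calc freqNormSq k = ∑ i : Fin 3, ((k i : ℝ)) ^ 2 := rfl
    _ ≤ ∑ _i : Fin 3, (R : ℝ) ^ 2 := Finset.sum_le_sum fun i _ => hki i
    _ = 3 * (R : ℝ) ^ 2 := by simp
    _ ≤ (L : ℝ) ^ 2 := h3

/-- `R = 4L/7` (integer division) satisfies `3R² ≤ L²`. [cite: Grafakos2014, §3.1.1] -/
theorem three_mul_sq_div_le (L : ℕ) : 3 * (4 * L / 7) ^ 2 ≤ L ^ 2 := by
  have h7 : 7 * (4 * L / 7) ≤ 4 * L := Nat.mul_div_le (4 * L) 7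
  have h49 : 49 * (4 * L / 7) ^ 2 ≤ 16 * L ^ 2 := by
    have := Nat.mul_le_mul h7 h7
    nlinarith [this]
  nlinarith

/-- The box radius `R = 4L/7` is at least `4L/7 − 1` and at most `4L/7` (real form). [folklore] -/
theorem box_radius_bounds (L : ℕ) : 4 * (L : ℝ) / 7 - 1 ≤ ((4 * L / 7 : ℕ) : ℝ) ∧ ((4 * L / 7 : ℕ) : ℝ) ≤ 4 * (L : ℝ) / 7 := by
  constructor
  · have h := Nat.lt_div_mul_add (a := 4 * L) (b := 7) (by norm_num)
    have h' : (4 * L : ℝ) < ((4 * L / 7 : ℕ) : ℝ) * 7 + 7 := by exact_mod_cast h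
    linarith
  · have h := Nat.div_mul_le_self (4 * L) 7
    have h' : ((4 * L / 7 : ℕ) : ℝ) * 7 ≤ (4 * L : ℝ) := by exact_mod_cast h
    linarith

/-! ## §2 The lacunary level sum -/

/-- `u e^{−u/α} ≤ α²/u` for `u, α > 0` (`t e^{−t} ≤ 1/t`, i.e. `t² ≤ e^t`). [folklore] -/
theorem mul_exp_neg_div_le_sq_div {u α : ℝ} (hu : 0 < u) (hα : 0 < α) : u * Real.exp (-(u / α)) ≤ α ^ 2 / u := by
  -- `t² ≤ 2 e^t` would suffice; we use `t²/2 ≤ e^t` from the Taylor bound `1 + t + t²/2 ≤ e^t`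
  set t : ℝ := u / α with ht
  have ht0 : 0 < t := div_pos hu hα
  have hexp : t ^ 2 / 2 ≤ Real.exp t := by
    have h := Real.quadratic_le_exp_of_nonneg ht0.le
    nlinarith
  -- `u e^{-t} ≤ α²/u  ⇔  u² ≤ α² e^{t}  ⇔  t² ≤ e^t` (with `u = α t`)
  rw [le_div_iff₀ hu, Real.exp_neg]
  have hut : u = α * t := by rw [ht]; field_simp
  rw [hut]
  have hexp0 : 0 < Real.exp t := Real.exp_pos t
  rw [inv_eq_one_div, mul_assoc, ← mul_assoc]
  have key : (α * t) * (1 / Real.exp t) * (α * t) = α ^ 2 * (t ^ 2 / Real.exp t) := by field_simp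
  rw [key]
  have h2 : t ^ 2 / Real.exp t ≤ 2 := by rw [div_le_iff₀ hexp0]; linarith
  -- we need `≤ 1`; sharpen: `t² ≤ e^t` for `t ≥ 0`
  have h1 : t ^ 2 / Real.exp t ≤ 1 := by
    rw [div_le_iff₀ hexp0, one_mul]
    -- `t² ≤ e^t`: for `t ≤ 2`, `t² ≤ 2t ≤ ... `; use `e^t ≥ 1 + t + t²/2 + t³/6` is not available; argue via `e^{t} ≥ (e^{t/2})²`
    -- and `e^{t/2} ≥ 1 + t/2 ≥ t/... `; simplest: `e^{t/2} ≥ t/2 + 1 ≥ t/2`, and also `e^{t/2} ≥ 1`, so `e^t ≥ (1 + t/2)^2 ≥ t`... use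
    -- `(1 + t/2)^2 = 1 + t + t²/4 ≥ t²/4 + t`; not enough. Use `e^{t/2} ≥ 1 + t/2 + t²/8`:
    have hh := Real.quadratic_le_exp_of_nonneg (by positivity : (0:ℝ) ≤ t / 2)
    have he2 : Real.exp t = Real.exp (t / 2) ^ 2 := by rw [← Real.exp_nat_mul]; ring_nf
    rw [he2]
    have hpos : 0 ≤ 1 + t / 2 + (t / 2) ^ 2 / 2 := by positivity
    calc t ^ 2 ≤ (1 + t / 2 + (t / 2) ^ 2 / 2) ^ 2 := by nlinarith [sq_nonneg (t - 2), sq_nonneg t]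
      _ ≤ Real.exp (t / 2) ^ 2 := pow_le_pow_left₀ hpos hh 2
  nlinarith [sq_nonneg α]

/-- Lacunary decay along the levels: `u_j ≤ u_i (1/2)^{j−i}` for `i ≤ j`, `u_i = L/N_{i+1}`, `2N_i ≤ N_{i+1}`. [folklore] -/
theorem lacunary_decay {N : ℕ → ℕ} (hN0 : ∀ i, 0 < N i) (hN2 : ∀ i, 2 * N i ≤ N (i + 1)) {L : ℝ} (hL : 0 ≤ L)
    {i j : ℕ} (hij : i ≤ j) : L / N (j + 1) ≤ L / N (i + 1) * (1 / 2) ^ (j - i) := by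
  induction j, hij using Nat.le_induction with
  | base => simp
  | succ j hij ih =>
    have h1 : (0 : ℝ) < N (j + 1) := by exact_mod_cast hN0 _
    have h2 : (2 : ℝ) * N (j + 1) ≤ N (j + 1 + 1) := by exact_mod_cast hN2 (j + 1)
    have h1' : (0 : ℝ) < N (j + 1 + 1) := by exact_mod_cast hN0 _
    have hstep : L / N (j + 1 + 1) ≤ L / N (j + 1) * (1 / 2) := by
      rw [div_mul_eq_mul_div, mul_one_div, div_div, div_le_div_iff₀ h1' (by positivity)]
      nlinarith
    calc L / N (j + 1 + 1) ≤ L / N (j + 1) * (1 / 2) := hstep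
      _ ≤ L / N (i + 1) * (1 / 2) ^ (j - i) * (1 / 2) := mul_le_mul_of_nonneg_right ih (by norm_num)
      _ = L / N (i + 1) * (1 / 2) ^ (j + 1 - i) := by rw [Nat.sub_add_comm hij, pow_succ]; ring

/-- Geometric tail: `Σ_{i ∈ s} (1/2)^{i − i₀} ≤ 2` over any finite set of indices `≥ i₀`, and `Σ_{i∈s} (1/2)^{i₁ − i} ≤ 2` over indices `≤ i₁`. [folklore] -/
theorem sum_half_pow_sub_le_two (s : Finset ℕ) (i₀ : ℕ) (hs : ∀ i ∈ s, i₀ ≤ i) :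
    ∑ i ∈ s, (1 / 2 : ℝ) ^ (i - i₀) ≤ 2 := by
  classical
  -- reindex by `j = i − i₀` injectively into `ℕ` and compare with the full geometric series
  have hinj : Set.InjOn (fun i => i - i₀) (s : Set ℕ) := by
    intro a ha b hb hab
    have ha' := hs a ha; have hb' := hs b hb
    simp only at hab; omega
  calc ∑ i ∈ s, (1 / 2 : ℝ) ^ (i - i₀) = ∑ j ∈ s.image (fun i => i - i₀), (1 / 2 : ℝ) ^ j := by
        rw [Finset.sum_image hinj]
    _ ≤ ∑' j : ℕ, (1 / 2 : ℝ) ^ j := (summable_geometric_two.sum_le_tsum _ (fun j _ => by positivity))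
    _ = 2 := tsum_geometric_two

/-- The mirrored geometric tail. [folklore] -/
theorem sum_half_pow_sub_le_two' (s : Finset ℕ) (i₁ : ℕ) (hs : ∀ i ∈ s, i ≤ i₁) :
    ∑ i ∈ s, (1 / 2 : ℝ) ^ (i₁ - i) ≤ 2 := by
  classical
  have hinj : Set.InjOn (fun i => i₁ - i) (s : Set ℕ) := by
    intro a ha b hb hab
    have ha' := hs a ha; have hb' := hs b hb
    simp only at hab; omega
  calc ∑ i ∈ s, (1 / 2 : ℝ) ^ (i₁ - i) = ∑ j ∈ s.image (fun i => i₁ - i), (1 / 2 : ℝ) ^ j := by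
        rw [Finset.sum_image hinj]
    _ ≤ ∑' j : ℕ, (1 / 2 : ℝ) ^ j := (summable_geometric_two.sum_le_tsum _ (fun j _ => by positivity))
    _ = 2 := tsum_geometric_two

/-- **The lacunary level sum.**  For cell counts with `2 N_i ≤ N_{i+1}` (all `i`), `N_i > 0`, and `L ≥ 0`, `α > 0`:
`Σ_{i<m} (L/N_{i+1}) exp(−(L/N_{i+1})/α) ≤ 4α`. [cite: ArmstrongVicol2025, §3 (3.42)–(3.43) (super-geometric separation of the scales)] -/
theorem lacunary_sum_mul_exp_le {N : ℕ → ℕ} (hN0 : ∀ i, 0 < N i) (hN2 : ∀ i, 2 * N i ≤ N (i + 1)) {L α : ℝ} (hL : 0 ≤ L)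
    (hα : 0 < α) (m : ℕ) :
    ∑ i ∈ Finset.range m, (L / N (i + 1)) * Real.exp (-((L / N (i + 1)) / α)) ≤ 4 * α := by
  classical
  rcases hL.eq_or_lt with hL0 | hLpos
  · rw [← hL0]; simp; positivity
  set u : ℕ → ℝ := fun i => L / N (i + 1) with hu
  have hu0 : ∀ i, 0 < u i := fun i => div_pos hLpos (by exact_mod_cast hN0 _)
  have hdec : ∀ {i j}, i ≤ j → u j ≤ u i * (1 / 2) ^ (j - i) := fun hij => lacunary_decay hN0 hN2 hL hij
  -- pointwise `f(u) ≤ min(u, α²/u)`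
  have hpt : ∀ i, u i * Real.exp (-(u i / α)) ≤ min (u i) (α ^ 2 / u i) := fun i =>
    le_min (mul_le_of_le_one_right (hu0 i).le (Real.exp_le_one_iff.2 (by
      have : 0 ≤ u i / α := (div_pos (hu0 i) hα).le; linarith))) (mul_exp_neg_div_le_sq_div (hu0 i) hα)
  -- split the range into small and big terms
  set I : Finset ℕ := (Finset.range m).filter (fun i => u i ≤ α) with hI
  set J : Finset ℕ := (Finset.range m).filter (fun i => ¬ u i ≤ α) with hJ
  have hsplit : ∑ i ∈ Finset.range m, min (u i) (α ^ 2 / u i) =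
      (∑ i ∈ I, min (u i) (α ^ 2 / u i)) + ∑ i ∈ J, min (u i) (α ^ 2 / u i) :=
    (Finset.sum_filter_add_sum_filter_not _ _ _).symm
  -- small terms: `Σ_{i∈I} u i ≤ 2α`
  have hsmall : ∑ i ∈ I, min (u i) (α ^ 2 / u i) ≤ 2 * α := by
    rcases I.eq_empty_or_nonempty with hIe | hIne
    · rw [hIe, Finset.sum_empty]; positivity
    · set i₀ := I.min' hIne with hi₀
      have hi₀I : i₀ ∈ I := Finset.min'_mem I hIne
      have hui₀ : u i₀ ≤ α := (Finset.mem_filter.1 hi₀I).2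
      calc ∑ i ∈ I, min (u i) (α ^ 2 / u i) ≤ ∑ i ∈ I, α * (1 / 2 : ℝ) ^ (i - i₀) := by
            refine Finset.sum_le_sum fun i hi => (min_le_left _ _).trans ?_
            have hle : i₀ ≤ i := Finset.min'_le I i hi
            calc u i ≤ u i₀ * (1 / 2) ^ (i - i₀) := hdec hle
              _ ≤ α * (1 / 2) ^ (i - i₀) := mul_le_mul_of_nonneg_right hui₀ (by positivity)
        _ = α * ∑ i ∈ I, (1 / 2 : ℝ) ^ (i - i₀) := by rw [Finset.mul_sum]
        _ ≤ α * 2 := mul_le_mul_of_nonneg_left (sum_half_pow_sub_le_two I i₀ fun i hi => Finset.min'_le I i hi) hα.le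
        _ = 2 * α := by ring
  -- big terms: `Σ_{i∈J} α²/u i ≤ 2α`
  have hbig : ∑ i ∈ J, min (u i) (α ^ 2 / u i) ≤ 2 * α := by
    rcases J.eq_empty_or_nonempty with hJe | hJne
    · rw [hJe, Finset.sum_empty]; positivity
    · set i₁ := J.max' hJne with hi₁
      have hi₁J : i₁ ∈ J := Finset.max'_mem J hJne
      have hui₁ : α < u i₁ := lt_of_not_ge (Finset.mem_filter.1 hi₁J).2
      calc ∑ i ∈ J, min (u i) (α ^ 2 / u i) ≤ ∑ i ∈ J, α * (1 / 2 : ℝ) ^ (i₁ - i) := by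
            refine Finset.sum_le_sum fun i hi => (min_le_right _ _).trans ?_
            have hle : i ≤ i₁ := Finset.le_max' J i hi
            -- `u i₁ ≤ u i (1/2)^{i₁−i}` ⇒ `α²/u i ≤ α² (1/2)^{i₁−i}/u i₁ ≤ α (1/2)^{i₁ - i}`
            have h1 := hdec hle
            have hui : 0 < u i := hu0 i
            rw [div_le_iff₀ hui]
            have h2 : α * u i₁ ≤ α * (u i * (1 / 2) ^ (i₁ - i)) := mul_le_mul_of_nonneg_left h1 hα.le
            nlinarith [pow_pos (by norm_num : (0:ℝ) < 1 / 2) (i₁ - i), hui]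
        _ = α * ∑ i ∈ J, (1 / 2 : ℝ) ^ (i₁ - i) := by rw [Finset.mul_sum]
        _ ≤ α * 2 := mul_le_mul_of_nonneg_left (sum_half_pow_sub_le_two' J i₁ fun i hi => Finset.le_max' J i hi) hα.le
        _ = 2 * α := by ring
  calc ∑ i ∈ Finset.range m, u i * Real.exp (-(u i / α)) ≤ ∑ i ∈ Finset.range m, min (u i) (α ^ 2 / u i) :=
        Finset.sum_le_sum fun i _ => hpt i
    _ = _ := hsplit
    _ ≤ 2 * α + 2 * α := add_le_add hsmall hbig
    _ = 4 * α := by ring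

end Summit.AnomalousDissipation.AnomalousDissipation.Theorems.SolenoidalFractalHomogenisation.LagrangianCarrierAnalytic

end
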